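import Literature.MathematicalPhysics.QuantumFieldTheory.ConformalBootstrap3D.PointKernelK34
import Literature.MathematicalPhysics.QuantumFieldTheory.ConformalBootstrap3D.PointKernelUnbounded

/-!
# The K34 point certificate, kernel-checked, on its production strip `[0.5175, 0.5185] × [1.6, ∞)`

`PointKernelK34.boxExcluded_K34` is `BoxExcluded ([207/400, 1037/2000] × [8/5, 24))`: the head cells
of the scalar row stop at `E₀ = 24`, so the assembled table theorem read the `ε`-obligation only below
`E₀`.  Above `E₀` the same certificate's (M) boxes and apex inequality (T) already give block
positivity at `ℓ = 0` (`PointKernelUnbounded`), so the SAME 226 kernel block theorems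
(`PointKernelK34H*`, `PointKernelK34M*`) and cheap checks give the unbounded strip — the box the
exact-rational verifiers of the publication run certify for this certificate
(`pointcert_K34_dsig5175-5185_deps1.6-inf_v1`): **no CFT data satisfying the bootstrap axioms of
`SigmaEpsilonSystem` has `0.5175 ≤ Δσ ≤ 0.5185` and `Δ_ε ≥ 1.6`.**  Historical context: the strip lies
inside the region carved out numerically by El-Showk–Paulos–Poland–Rychkov–Simmons-Duffin–Vichi,
arXiv:1203.6064 (Fig. 3).
-/

namespace Literature.MathematicalPhysics.QuantumFieldTheory.ConformalBootstrap3D.PointKernelK34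

open Literature.MathematicalPhysics.QuantumFieldTheory.ConformalBootstrap3D Literature.MathematicalPhysics.QuantumFieldTheory.ConformalBootstrap3D.PointKernel

/-- **The K34 exclusion strip is a theorem of the kernel**:
`BoxExcluded ([207/400, 1037/2000] × [8/5, ∞))`. [folklore] -/
theorem boxExcluded_K34_unbounded : BoxExcluded (QBoxU (207 / 400) (1037 / 2000) (8 / 5)) :=
  PCert.boxExcluded_of_kernelC_unbounded cert_checkNodes cert_sideOK 18 cert_o1OKC qd qr 120 cert_tOK
    (8 / 5) 24 1 23 119 cert_paramOK (by norm_num) hsegs cert_hMetaOK mrows cert_mMetaOK hcells hboxes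

-- (The bounded box `boxExcluded_K34` of `PointKernelK34` is the special case `Δε < 24` of the strip,
-- via `qBox_subset_qBoxU`; it is already landed and not restated here.)

/-- The same, unfolded: no solution of the `σ`-`ε` bootstrap system has
`0.5175 ≤ Δσ ≤ 0.5185` and `1.6 ≤ Δ_ε`. [folklore] -/
theorem no_cft_in_K34_strip (D : SigmaEpsilonData) (hD : D.SatisfiesBootstrapAxioms)
    (h1 : (0.5175 : ℝ) ≤ D.Δσ) (h2 : D.Δσ ≤ 0.5185) (h3 : (1.6 : ℝ) ≤ D.Δε) : False := by
  refine boxExcluded_K34_unbounded D hD ?_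
  simp only [QBoxU, Set.mem_setOf_eq]
  refine ⟨⟨?_, ?_⟩, ?_⟩ <;> push_cast <;> linarith

/-- Equivalently: inside the column `0.5175 ≤ Δσ ≤ 0.5185` every solution has `Δ_ε < 1.6`.
[folklore] -/
theorem epsDim_lt_of_K34_column (D : SigmaEpsilonData) (hD : D.SatisfiesBootstrapAxioms)
    (h1 : (0.5175 : ℝ) ≤ D.Δσ) (h2 : D.Δσ ≤ 0.5185) : D.Δε < 1.6 := by
  by_contra h
  exact no_cft_in_K34_strip D hD h1 h2 (not_lt.1 h)

end Literature.MathematicalPhysics.QuantumFieldTheory.ConformalBootstrap3D.PointKernelK34
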